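import Summits.QuantumFields.BalabanUV.Gaps.EndTopRunCriterion

/-!
# Gaps / EndContLetterWitness — NEGATIVE N-15: on the ORDER roads to the END binder the continuity letter (C) CANNOT be dropped — ONE Markov
# family (the FLOOR STAIRCASE `β_{k+1}(g_0,…,g_k) := 1∕(⌊1∕g_k⌋₊ + 1)`) carries every order-road letter and the top-run condition at every level,
# yet its canonical construction has NO `EndpointExistence` — a PORT into the tree, with attribution, of g1-plan-2 GEN 17's lens kernel
# `HOME/g1/skeletons/XreadHordFadingMemory_plan2.lean` (v1.8, sha16 4a2dd778a9e40b0b, §9; lens item S-42 ∕ R-34 = NEGATIVE N-15; offered for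
# porting in [G1-PLAN2-G17-S42])
# (cell pub-balaban-gaps, seat g1-p3 gen 7, row CAP+tail ∕ β-currency «split ∕ weakening»; file 3 of 4 of «the binder census of the END roads»)

HONEST FRAMING (cell rule, page 1 of everything): a TOY β-family (real analysis on an explicit construction; all non-flow fields of `modelOf`
junk) over the tree's typed carriers (`FlowStep.HBeta` ∕ `Box` ∕ `RGEqH` ∕ `solveCoupling` ∕ `genSeq`, `DagBinding.EndpointExistence` ∕ `modelOf`).
AUTHORSHIP: the mathematics and the Lean text of every declaration below are g1-plan-2 GEN 17's (planner seat; planners file nothing on the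
ledger by mandate — «provers may port»); this seat's contribution is the port (namespace, imports, this header, references to the tree's (D) ∕ (G)
∕ (H) in place of the kernel's internal §-numbers, and THREE proofs re-routed so that the leaf imports (D) only: `hord_betaJ` through (D)'s
`strictOrder_ofMarkov`, `run_lt_succ_betaJ` with (H)'s two-line `lt_of_invSqGap_pos` inlined, `not_betaContH_betaJ` through (D) + `hord_betaJ`
instead of the kernel's un-ported §8 criterion; all STATEMENTS unchanged) and the kernel re-check against the tree.  Bałaban's β-functions are ASSERTED smooth in the coupling in print
([I] §1 pp. 263–264; no located proof — the cell's letter (C), GAPS G-adv2-3 ∕ G-adv2-6) and nothing here says otherwise: the statements are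
about the HYPOTHESIS SETS of the tree's END criteria ((D) `Gaps/EndTopRunCriterion`, (G) `Gaps/EndTopRunCooperative`, (H)
`Gaps/EndTopRunFadingMemory`, `Gaps/EndContAlongFoliation`).  NOTHING of Bałaban's is asserted; 0∕6 binders; 0 coefficients certified; words ∕
odds UNCHANGED; one finite T⁴; NOT B12 Thm 2, NOT `BetaPertH`, NOT the continuum limit, NOT Clay.

THE POINT (g1-plan-2 S-42 ∕ R-34, verbatim in substance).  (H) recorded a PRICE: one-sided history moduli — in particular the SIGN road (G)
(β cooperative in the earlier couplings with increasing last-coupling step maps) — give NO continuity, so `BetaContH` stays a separate letter of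
the END criteria, whereas two-sided moduli CONTAIN it (`T4CurrencyMatching`).  This leaf certifies that the price is a property of the CRITERION,
not of its proof.  The FLOOR STAIRCASE `β_{k+1}(g_0, …, g_k) := φ(g_k)`, `φ x := 1 ∕ (⌊1∕x⌋₊ + 1)` is positive, `≤ 1`, non-decreasing in `g_k`
(hence: cooperative, one-sided moduli `Λ ≡ 0`, (G)'s strictly increasing step maps, (D)'s `hord` at every level), satisfies the TOP-RUN
condition at EVERY level with `g⋆ = γ` (its runs increase), and yet `modelOf β` has NO `EndpointExistence`: the jumps of `φ` at `g_0 = 1∕n`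
PUNCTURE the range of the one-step map `g_0 ↦ g_1`, `1∕g_1² = 1∕g_0² − φ(g_0)`, at the couplings `g⋆_n = (n² − 2∕(2n+1))^{−1∕2} ↓ 0`, so NO
`g⋆ > 0` is an endpoint window, already for `K = 1` (**`not_endpointExistence_betaJ`**).  Consequences: (D)'s `endpointExistence_modelOf_iff_topRuns`,
the diagonal road of (H) and (G)'s `endpointExistence_modelOf_iff_topRuns_of_cooperative` are each FALSE with the binder `hcont : BetaContH γ₀ β`
deleted (`…_false_without_hcont`, all other binders kept, at `γ₀ = 1`, `β′ = 1`, `L = 0`); the staircase is `BetaContH` at no level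
(`not_betaContH_betaJ`, DERIVED from the criterion); that it is discontinuous even ALONG THE CLAMPED FOLIATION (the (C) column of the census:
trace continuity load-bearing, continuity off the foliation spare) is recorded in `Gaps/EndUpperLetterWitness` with `Gaps/EndContAlongFoliation`.
R-34 (zero weight): on the END node ORDER and CONTINUITY are independent letters on the sign road.
0 sorry; FOUR toy definitions (`stair`, `betaJ`, `uJ`, `gJ` — explicit real functions ∕ numbers, no `def … : Prop`); imports (D)
`Gaps/EndTopRunCriterion` only (re-exports (A), `FlowStepRuns`, `DagBinding`); restates nothing of the tree.  CITATION HEADER (tags CONTEXT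
ONLY): [I] = T. Bałaban, Commun. Math. Phys. **109** (1987) [Balaban1987RG1]: Thm 2 p. 259, (0.20) p. 256, §1 pp. 263–264.
-/

namespace Summit.QuantumFields.BalabanUV.Gaps.EndContLetterWitness

open Literature.MathematicalPhysics.QuantumFieldTheory.Balaban1983to89
open Literature.MathematicalPhysics.QuantumFieldTheory.Balaban1983to89.FlowStep
open Literature.MathematicalPhysics.QuantumFieldTheory.Balaban1983to89.FlowStepRuns
open Literature.MathematicalPhysics.QuantumFieldTheory.Balaban1983to89.DagBinding
open Summit.QuantumFields.BalabanUV.Gaps.EndRunwiseShooting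
open Summit.QuantumFields.BalabanUV.Gaps.EndTopRunCriterion
open Topology Finset

noncomputable section

/-! ## §1 The floor staircase and the family `betaJ`: every order-road letter, top runs at every level (g1-plan-2 kernel §9, ported) -/

/-- The FLOOR STAIRCASE `φ x = 1 ∕ (⌊1∕x⌋₊ + 1)`: values in `]0, 1]`, non-decreasing on `]0, ∞[`, a jump at every `x = 1∕n`. [folklore] -/
def stair (x : ℝ) : ℝ := 1 / ((⌊1 / x⌋₊ : ℝ) + 1)

/-- `0 < φ`. [folklore] -/
theorem stair_pos (x : ℝ) : 0 < stair x := by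
  unfold stair; positivity

/-- `φ ≤ 1`. [folklore] -/
theorem stair_le_one (x : ℝ) : stair x ≤ 1 := by
  unfold stair
  rw [div_le_one (by positivity)]
  have h : (0 : ℝ) ≤ (⌊1 / x⌋₊ : ℝ) := Nat.cast_nonneg _
  linarith

/-- `φ` is non-decreasing on `]0, ∞[`. [folklore] -/
theorem stair_mono {x y : ℝ} (hx : 0 < x) (hxy : x ≤ y) : stair x ≤ stair y := by
  unfold stair
  have h : (⌊1 / y⌋₊ : ℝ) ≤ (⌊1 / x⌋₊ : ℝ) := by
    exact_mod_cast Nat.floor_mono (one_div_le_one_div_of_le hx hxy)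
  exact one_div_le_one_div_of_le (by positivity) (by linarith)

/-- Below the `n`-th jump: `x ≤ 1∕n ⇒ φ x ≤ 1∕(n+1)`. [folklore] -/
theorem stair_le_of_le {x : ℝ} {n : ℕ} (hn : 0 < (n : ℝ)) (hx : 0 < x) (h : x ≤ 1 / (n : ℝ)) :
    stair x ≤ 1 / ((n : ℝ) + 1) := by
  unfold stair
  have h1 : (n : ℝ) ≤ 1 / x := by
    rw [le_div_iff₀ hx]
    calc (n : ℝ) * x ≤ n * (1 / n) := by gcongr
      _ = 1 := by field_simp
  have h2 : (n : ℝ) ≤ (⌊1 / x⌋₊ : ℝ) := by exact_mod_cast Nat.le_floor h1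
  exact one_div_le_one_div_of_le (by positivity) (by linarith)

/-- Above the `n`-th jump: `1∕n < x ⇒ 1∕n ≤ φ x`. [folklore] -/
theorem stair_ge_of_gt {x : ℝ} {n : ℕ} (hn : 0 < (n : ℝ)) (h : 1 / (n : ℝ) < x) : 1 / (n : ℝ) ≤ stair x := by
  unfold stair
  have hx : 0 < x := lt_trans (by positivity) h
  have h1 : 1 / x < n := by
    rw [div_lt_iff₀ hx]
    calc (1 : ℝ) = n * (1 / n) := by field_simp
      _ < n * x := by gcongr
  have h2 : ⌊1 / x⌋₊ < n := (Nat.floor_lt (by positivity)).mpr h1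
  have h3 : (⌊1 / x⌋₊ : ℝ) + 1 ≤ n := by exact_mod_cast Nat.succ_le_of_lt h2
  exact one_div_le_one_div_of_le (by positivity) h3

/-- The STAIRCASE FAMILY (Markov): `β_{k+1}(g_0, …, g_k) := φ(g_k)`. [folklore] -/
def betaJ : HBeta := fun k p => stair (p (Fin.last k))

/-- Unfolding. [folklore] -/
theorem betaJ_apply (k : ℕ) (p : Fin (k + 1) → ℝ) : betaJ k p = stair (p (Fin.last k)) := rfl

/-- SIGN: `0 ≤ β` on every box. [folklore] -/
theorem betaLowerH_betaJ (γ : ℝ) : BetaLowerH 0 γ betaJ := fun _ _ _ => (stair_pos _).le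

/-- (U): `β ≤ 1` on every box. [folklore] -/
theorem betaUpperH_betaJ (γ : ℝ) : BetaUpperH 1 γ betaJ := fun _ _ _ => stair_le_one _

/-- (G)'s (ii) (`Gaps/EndTopRunCooperative`), COOPERATIVE in the earlier couplings (trivially: Markov). [folklore] -/
theorem cooperative_betaJ (γ : ℝ) : ∀ (k : ℕ) (v v' : Fin (k + 1) → ℝ), v ∈ Box γ k → v' ∈ Box γ k → (∀ i, v i ≤ v' i) →
    v (Fin.last k) = v' (Fin.last k) → betaJ k v ≤ betaJ k v' := by
  intro k v v' _ _ _ hlast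
  rw [betaJ_apply, betaJ_apply, hlast]

/-- (H)'s UNIFORM diagonal hypothesis (`EndTopRunFadingMemory.hord_of_cooperative_diag`) with `L = 0`: `β` non-decreasing in the last coupling. [folklore] -/
theorem diag_betaJ (γ : ℝ) : ∀ (k : ℕ) (v : Fin (k + 1) → ℝ), v ∈ Box γ k → ∀ x y : ℝ, 0 < x → x ≤ y → y ≤ γ →
    betaJ k (Function.update v (Fin.last k) x) - betaJ k (Function.update v (Fin.last k) y) ≤ 0 * (1 / x ^ 2 - 1 / y ^ 2) := by
  intro k v _ x y hx hxy _
  rw [betaJ_apply, betaJ_apply, Function.update_self, Function.update_self, zero_mul, sub_nonpos]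
  exact stair_mono hx hxy

/-- (G)'s (i): STRICTLY increasing last-coupling step maps. [folklore] -/
theorem anti_betaJ (γ : ℝ) : ∀ (k : ℕ) (v : Fin (k + 1) → ℝ), v ∈ Box γ k → ∀ x y : ℝ, 0 < x → x < y → y ≤ γ →
    1 / y ^ 2 - betaJ k (Function.update v (Fin.last k) y) < 1 / x ^ 2 - betaJ k (Function.update v (Fin.last k) x) := by
  intro k v _ x y hx hxy _
  rw [betaJ_apply, betaJ_apply, Function.update_self, Function.update_self]
  have h1 : 1 / y ^ 2 < 1 / x ^ 2 := one_div_lt_one_div_of_lt (by positivity) (by gcongr)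
  have h2 : stair x ≤ stair y := stair_mono hx hxy.le
  linarith

/-- (H)'s ONE-SIDED history moduli with `Λ ≡ 0`. [folklore] -/
theorem oneSided_betaJ (γ : ℝ) : ∀ (k : ℕ) (v v' : Fin (k + 1) → ℝ), v ∈ Box γ k → v' ∈ Box γ k → (∀ i, v i ≤ v' i) →
    betaJ k v - betaJ k v' ≤ ∑ i : Fin (k + 1), (fun (_ : ℕ) (_ : ℕ) => (0 : ℝ)) k i * (1 / (v i) ^ 2 - 1 / (v' i) ^ 2) := by
  intro k v v' hv _ hle
  simp only [zero_mul, Finset.sum_const_zero, sub_nonpos, betaJ_apply]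
  exact stair_mono ((mem_box.mp hv) (Fin.last k)).1 (hle _)

/-- (D)'s non-crossing hypothesis `hord` at EVERY level `γ ≤ γ₀` (the family is Markov — `betaJ = ofMarkov (fun _ => stair)` definitionally —
with strictly increasing step maps: (D)'s `strictOrder_ofMarkov`; equally (H)'s `hord_of_cooperative_diag` with `L = 0`). [folklore] -/
theorem hord_betaJ {γ₀ : ℝ} : ∀ γ : ℝ, 0 < γ → γ ≤ γ₀ → ∀ (n : ℕ) (gs gs' : ℕ → ℝ),
    RGEqH n betaJ gs → RGEqH n betaJ gs' → Step.InInterval γ n gs → Step.InInterval γ n gs' → gs 0 < gs' 0 →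
      ∀ k, k ≤ n → gs k < gs' k := by
  intro γ _ _ n gs gs' hrg hrg' hI hI' h0
  have hanti : ∀ (k : ℕ) (x y : ℝ), 0 < x → x < y → y ≤ γ →
      1 / y ^ 2 - (fun (_ : ℕ) (x : ℝ) => stair x) (k + 1) y < 1 / x ^ 2 - (fun (_ : ℕ) (x : ℝ) => stair x) (k + 1) x := by
    intro k x y hx hxy _
    have h1 : 1 / y ^ 2 < 1 / x ^ 2 := one_div_lt_one_div_of_lt (by positivity) (by gcongr)
    have h2 : stair x ≤ stair y := stair_mono hx hxy.le
    show 1 / y ^ 2 - stair y < 1 / x ^ 2 - stair x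
    linarith
  exact strictOrder_ofMarkov (βM := fun (_ : ℕ) (x : ℝ) => stair x) hanti hrg hrg' hI hI' h0

/-- Runs of the staircase family INCREASE strictly (`β > 0`). [folklore] -/
theorem run_lt_succ_betaJ {γ : ℝ} {n : ℕ} {gs : ℕ → ℝ} (hrg : RGEqH n betaJ gs) (hI : Step.InInterval γ n gs) :
    ∀ k, k < n → gs k < gs (k + 1) := by
  intro k hk
  have hpos : 0 < gs (k + 1) := (hI (k + 1) hk).1
  have h := hrg k hk
  have hβ : 0 < betaJ k (prefixOf gs k) := stair_pos _
  have hgap : 1 / (gs (k + 1)) ^ 2 < 1 / (gs k) ^ 2 := by linarith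
  by_contra hle
  have h' : 1 / (gs k) ^ 2 ≤ 1 / (gs (k + 1)) ^ 2 :=
    one_div_le_one_div_of_le (pow_pos hpos 2) (pow_le_pow_left₀ hpos.le (not_lt.mp hle) 2)
  linarith

/-- … hence are MONOTONE: `k ≤ j ≤ n ⇒ g_k ≤ g_j`. [folklore] -/
theorem run_mono_betaJ {γ : ℝ} {n : ℕ} {gs : ℕ → ℝ} (hrg : RGEqH n betaJ gs) (hI : Step.InInterval γ n gs) :
    ∀ j k, k ≤ j → j ≤ n → gs k ≤ gs j := by
  intro j
  induction j with
  | zero =>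
    intro k hk _
    rw [Nat.le_zero.mp hk]
  | succ j ih =>
    intro k hk hjn
    rcases Nat.lt_or_eq_of_le hk with h | h
    · exact (ih k (Nat.lt_succ_iff.mp h) (Nat.le_of_succ_le hjn)).trans (run_lt_succ_betaJ hrg hI j hjn).le
    · rw [h]

/-- TOP RUNS at EVERY level with `g⋆ = γ`: an in-interval run that sits at `γ` at some step ends `≥ γ`. [folklore] -/
theorem topRuns_betaJ {γ : ℝ} (n : ℕ) (gs : ℕ → ℝ) (hrg : RGEqH n betaJ gs) (hI : Step.InInterval γ n gs) :
    ∀ k, k ≤ n → gs k = γ → γ ≤ gs n := by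
  intro k hk hkγ
  rw [← hkγ]
  exact run_mono_betaJ hrg hI n k hk le_rfl

/-- The right-hand side of the top-run CRITERION holds for the staircase family (`γ₂ := 1`, `g⋆ := γ`). [folklore] -/
theorem topRunCriterion_betaJ : ∃ γ₂ : ℝ, 0 < γ₂ ∧ ∀ γ : ℝ, 0 < γ → γ ≤ γ₂ → ∃ gstar : ℝ, 0 < gstar ∧
    ∀ (n : ℕ) (gs : ℕ → ℝ), RGEqH n betaJ gs → Step.InInterval γ n gs → ∀ k, k ≤ n → gs k = γ → gstar ≤ gs n :=
  ⟨1, one_pos, fun γ hγ _ => ⟨γ, hγ, fun n gs hrg hI => topRuns_betaJ n gs hrg hI⟩⟩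

/-! ## §2 The punctured couplings: `modelOf betaJ` has NO `EndpointExistence` (kernel §9, ported) -/

/-- The punctured VALUE `u⋆_n := n² − 2∕(2n+1)`. [folklore] -/
def uJ (n : ℕ) : ℝ := (n : ℝ) ^ 2 - 2 / (2 * (n : ℝ) + 1)

/-- `u⋆_n > 0` for `n ≥ 1`. [folklore] -/
theorem uJ_pos {n : ℕ} (hn : 1 ≤ (n : ℝ)) : 0 < uJ n := by
  unfold uJ
  have h1 : 2 / (2 * (n : ℝ) + 1) ≤ 2 / 3 := div_le_div_of_nonneg_left (by norm_num) (by norm_num) (by linarith)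
  nlinarith

/-- `u⋆_n` lies ABOVE the values `1∕x² − φ x`, `x > 1∕n` (all `< n² − 1∕n`). [folklore] -/
theorem gap_below {n : ℕ} (hn : 0 < (n : ℝ)) : (n : ℝ) ^ 2 - 1 / n ≤ uJ n := by
  unfold uJ
  have h : 2 / (2 * (n : ℝ) + 1) ≤ 1 / n := by
    rw [div_le_div_iff₀ (by positivity) (by positivity)]; linarith
  linarith

/-- `u⋆_n` lies BELOW the values `1∕x² − φ x`, `x ≤ 1∕n` (all `≥ n² − 1∕(n+1)`). [folklore] -/
theorem gap_above {n : ℕ} (hn : 0 < (n : ℝ)) : uJ n < (n : ℝ) ^ 2 - 1 / ((n : ℝ) + 1) := by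
  unfold uJ
  have h : 1 / ((n : ℝ) + 1) < 2 / (2 * (n : ℝ) + 1) := by
    rw [div_lt_div_iff₀ (by positivity) (by positivity)]; linarith
  linarith

/-- The GAP: no `x > 0` solves `1∕x² − φ x = u⋆_n`. [folklore] -/
theorem invSq_sub_stair_ne_uJ {n : ℕ} (hn : 0 < (n : ℝ)) {x : ℝ} (hx : 0 < x) : 1 / x ^ 2 - stair x ≠ uJ n := by
  intro h
  rcases le_or_gt x (1 / (n : ℝ)) with hle | hlt
  · have h1 : (n : ℝ) ^ 2 ≤ 1 / x ^ 2 := by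
      have hx2 : x ^ 2 ≤ (1 / (n : ℝ)) ^ 2 := by gcongr
      calc (n : ℝ) ^ 2 = 1 / (1 / (n : ℝ)) ^ 2 := by rw [div_pow, one_pow, one_div_one_div]
        _ ≤ 1 / x ^ 2 := one_div_le_one_div_of_le (by positivity) hx2
    have h2 := stair_le_of_le hn hx hle
    have h3 := gap_above hn
    linarith
  · have h1 : 1 / x ^ 2 < (n : ℝ) ^ 2 := by
      have hx2 : (1 / (n : ℝ)) ^ 2 < x ^ 2 := by gcongr
      calc 1 / x ^ 2 < 1 / (1 / (n : ℝ)) ^ 2 := one_div_lt_one_div_of_lt (by positivity) hx2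
        _ = (n : ℝ) ^ 2 := by rw [div_pow, one_pow, one_div_one_div]
    have h2 := stair_ge_of_gt hn hlt
    have h3 := gap_below hn
    linarith

/-- The punctured COUPLING `g⋆_n := solveCoupling u⋆_n = (u⋆_n)^{−1∕2}`. [folklore] -/
def gJ (n : ℕ) : ℝ := solveCoupling (uJ n)

/-- `g⋆_n > 0`. [folklore] -/
theorem gJ_pos {n : ℕ} (hn : 1 ≤ (n : ℝ)) : 0 < gJ n := solveCoupling_pos (uJ_pos hn)

/-- `1∕(g⋆_n)² = u⋆_n`. [folklore] -/
theorem inv_sq_gJ {n : ℕ} (hn : 1 ≤ (n : ℝ)) : 1 / (gJ n) ^ 2 = uJ n := inv_sq_solveCoupling (uJ_pos hn)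

/-- `g⋆_n ≤ g` as soon as `1∕g² ≤ u⋆_n`. [folklore] -/
theorem gJ_le {n : ℕ} (hn : 1 ≤ (n : ℝ)) {g : ℝ} (hg : 0 < g) (h : 1 / g ^ 2 ≤ uJ n) : gJ n ≤ g := by
  have h1 : 1 / g ^ 2 ≤ 1 / (gJ n) ^ 2 := by rw [inv_sq_gJ hn]; exact h
  have h2 : (gJ n) ^ 2 ≤ g ^ 2 := (one_div_le_one_div (pow_pos hg 2) (pow_pos (gJ_pos hn) 2)).mp h1
  nlinarith [gJ_pos hn, hg, h2]

/-- The flow of the canonical construction IS the generated sequence. [folklore] -/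
theorem modelOf_flow_g (β : HBeta) (P : B12.RunParams) : (modelOf β P).flow.g = genSeq β P.g0 := rfl

/-- **NO END (N-15)**: the canonical construction of the staircase family has NO `EndpointExistence` — every window `]0, g⋆]`
contains a punctured coupling `g⋆_n`, which is `g_1` of NO run (`K = 1`, any torus exponent `m`). [folklore] -/
theorem not_endpointExistence_betaJ : ¬ EndpointExistence (modelOf betaJ) := by
  intro hE
  obtain ⟨γ₂, hγ₂, h⟩ := hE 0
  obtain ⟨gstar, hgstar, h⟩ := h γ₂ hγ₂ le_rfl
  -- the jump index: `n - 1 ≥ 1∕g⋆`, `n ≥ 1`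
  obtain ⟨n, hn1, hceil⟩ : ∃ n : ℕ, (1 : ℝ) ≤ n ∧ 1 / gstar ≤ (n : ℝ) - 1 :=
    ⟨⌈1 / gstar⌉₊ + 1, by push_cast; linarith [Nat.cast_nonneg (α := ℝ) ⌈1 / gstar⌉₊],
      by push_cast; linarith [Nat.le_ceil (1 / gstar)]⟩
  have hn0 : (0 : ℝ) < n := by linarith
  -- the punctured coupling lies in the window: `1∕g⋆² ≤ (n−1)² ≤ n² − 1∕n ≤ u⋆_n`
  have hwin : 1 / gstar ^ 2 ≤ uJ n := by
    have h1 : 1 / gstar ^ 2 = (1 / gstar) ^ 2 := by rw [div_pow, one_pow]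
    have h2 : (1 / gstar) ^ 2 ≤ ((n : ℝ) - 1) ^ 2 := by gcongr
    have h3 := gap_below hn0
    have h4 : 1 / (n : ℝ) ≤ 1 := by rw [div_le_one hn0]; exact hn1
    nlinarith
  obtain ⟨g0, hI, hK⟩ := h (gJ n) (gJ_pos hn1) (gJ_le hn1 hgstar hwin) 1
  -- read the run: `g_0 = g0 > 0`, `g_1 = solveCoupling (1∕g0² − φ g0) = g⋆_n`
  have hP0 : 0 < genSeq betaJ g0 0 ∧ genSeq betaJ g0 0 ≤ γ₂ := hI 0 (Nat.zero_le _)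
  have hK' : genSeq betaJ g0 1 = gJ n := hK
  rw [genSeq_zero] at hP0
  have hβ0 : betaJ 0 (prefixOf (genSeq betaJ g0) 0) = stair g0 := by
    simp only [betaJ_apply, prefixOf_apply, Fin.val_last, genSeq_zero]
  rw [genSeq_succ, genSeq_zero, hβ0] at hK'
  have hy : 0 < 1 / g0 ^ 2 - stair g0 := by
    by_contra hneg
    have h1 := solveCoupling_nonpos (not_lt.mp hneg)
    linarith [gJ_pos hn1]
  have hval : 1 / g0 ^ 2 - stair g0 = uJ n := by
    have h1 := inv_sq_solveCoupling hy
    rw [hK', inv_sq_gJ hn1] at h1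
    exact h1.symm
  exact invSq_sub_stair_ne_uJ hn0 hP0.1 hval

/-! ## §3 N-15: the END criteria of (D) ∕ (H) ∕ (G) are FALSE with the continuity binder deleted (kernel §9, ported) -/

/-- **N-15 (a): (D)'s END criterion `endpointExistence_modelOf_iff_topRuns` is FALSE with its continuity binder deleted** — even for a
Markov, positive, bounded family with (D)'s `hord` at every level. [folklore] -/
theorem endTopRunCriterion_false_without_hcont :
    ¬ ∀ (β : HBeta) (γ₀ β' : ℝ), 0 < γ₀ → 0 ≤ β' → BetaUpperH β' γ₀ β →
      (∀ γ : ℝ, 0 < γ → γ ≤ γ₀ → ∀ (n : ℕ) (gs gs' : ℕ → ℝ), RGEqH n β gs → RGEqH n β gs' →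
        Step.InInterval γ n gs → Step.InInterval γ n gs' → gs 0 < gs' 0 → ∀ k, k ≤ n → gs k < gs' k) →
      (EndpointExistence (modelOf β) ↔
        ∃ γ₂ : ℝ, 0 < γ₂ ∧ ∀ γ : ℝ, 0 < γ → γ ≤ γ₂ → ∃ gstar : ℝ, 0 < gstar ∧
          ∀ (n : ℕ) (gs : ℕ → ℝ), RGEqH n β gs → Step.InInterval γ n gs → ∀ k, k ≤ n → gs k = γ → gstar ≤ gs n) := by
  intro h
  exact not_endpointExistence_betaJ ((h betaJ 1 1 one_pos zero_le_one (betaUpperH_betaJ 1) hord_betaJ).mpr topRunCriterion_betaJ)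

/-- **N-15 (b): the END criterion on (H)'s diagonal road — (D) composed with `EndTopRunFadingMemory.hord_of_cooperative_diag` (cooperative past,
diagonal modulus `L < 1`) — is FALSE with its continuity binder deleted** (witness at `γ₀ = β′ = 1`, `L = 0`). [folklore] -/
theorem endCriterion_cooperative_diag_false_without_hcont :
    ¬ ∀ (β : HBeta) (γ₀ β' L : ℝ), 0 < γ₀ → 0 ≤ β' → BetaUpperH β' γ₀ β →
      (∀ (k : ℕ) (v v' : Fin (k + 1) → ℝ), v ∈ Box γ₀ k → v' ∈ Box γ₀ k → (∀ i, v i ≤ v' i) →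
        v (Fin.last k) = v' (Fin.last k) → β k v ≤ β k v') →
      (∀ (k : ℕ) (v : Fin (k + 1) → ℝ), v ∈ Box γ₀ k → ∀ x y : ℝ, 0 < x → x ≤ y → y ≤ γ₀ →
        β k (Function.update v (Fin.last k) x) - β k (Function.update v (Fin.last k) y) ≤ L * (1 / x ^ 2 - 1 / y ^ 2)) →
      0 ≤ L → L < 1 →
      (EndpointExistence (modelOf β) ↔
        ∃ γ₂ : ℝ, 0 < γ₂ ∧ ∀ γ : ℝ, 0 < γ → γ ≤ γ₂ → ∃ gstar : ℝ, 0 < gstar ∧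
          ∀ (n : ℕ) (gs : ℕ → ℝ), RGEqH n β gs → Step.InInterval γ n gs → ∀ k, k ≤ n → gs k = γ → gstar ≤ gs n) := by
  intro h
  exact not_endpointExistence_betaJ
    ((h betaJ 1 1 0 one_pos zero_le_one (betaUpperH_betaJ 1) (cooperative_betaJ 1) (diag_betaJ 1) le_rfl zero_lt_one).mpr topRunCriterion_betaJ)

/-- **N-15 (c): (G)'s `EndTopRunCooperative.endpointExistence_modelOf_iff_topRuns_of_cooperative` is FALSE with its continuity binder deleted** —
its hypotheses (i) strictly increasing step maps and (ii) cooperative restated verbatim. [folklore] -/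
theorem endCriterion_cooperative_false_without_hcont :
    ¬ ∀ (β : HBeta) (γ₀ β' : ℝ), 0 < γ₀ → 0 ≤ β' → BetaUpperH β' γ₀ β →
      (∀ (k : ℕ) (v : Fin (k + 1) → ℝ), v ∈ Box γ₀ k → ∀ x y : ℝ, 0 < x → x < y → y ≤ γ₀ →
        1 / y ^ 2 - β k (Function.update v (Fin.last k) y) < 1 / x ^ 2 - β k (Function.update v (Fin.last k) x)) →
      (∀ (k : ℕ) (v v' : Fin (k + 1) → ℝ), v ∈ Box γ₀ k → v' ∈ Box γ₀ k → (∀ i, v i ≤ v' i) →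
        v (Fin.last k) = v' (Fin.last k) → β k v ≤ β k v') →
      (EndpointExistence (modelOf β) ↔
        ∃ γ₂ : ℝ, 0 < γ₂ ∧ ∀ γ : ℝ, 0 < γ → γ ≤ γ₂ → ∃ gstar : ℝ, 0 < gstar ∧
          ∀ (n : ℕ) (gs : ℕ → ℝ), RGEqH n β gs → Step.InInterval γ n gs → ∀ k, k ≤ n → gs k = γ → gstar ≤ gs n) := by
  intro h
  exact not_endpointExistence_betaJ
    ((h betaJ 1 1 one_pos zero_le_one (betaUpperH_betaJ 1) (anti_betaJ 1) (cooperative_betaJ 1)).mpr topRunCriterion_betaJ)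

/-- … and, read THROUGH (D): the staircase family is NOT `BetaContH` at any level `γ₀ > 0` — a discontinuity DERIVED from the END criterion
(top-runs hold, the END fails, every other binder holds). [folklore] -/
theorem not_betaContH_betaJ {γ₀ : ℝ} (hγ₀ : 0 < γ₀) : ¬ BetaContH γ₀ betaJ := fun hcont =>
  not_endpointExistence_betaJ ((endpointExistence_modelOf_iff_topRuns hγ₀ zero_le_one hcont (betaUpperH_betaJ γ₀)
    hord_betaJ).mpr topRunCriterion_betaJ)

/-- **S-42 ∕ R-34 — THE WITNESS OF RECORD (N-15)**: ONE history family carrying EVERY order-road letter — sign, (U), cooperative,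
(H)'s diagonal bound with `L = 0`, (G)'s strictly increasing step maps, (H)'s one-sided moduli `Λ ≡ 0`, (D)'s `hord` at every
level `≤ 1`, the top-run condition at every level with `g⋆ = γ` — whose canonical construction has NO `EndpointExistence` and
which is continuous at NO level: on the order roads the continuity letter (C) is LOAD-BEARING, not a convenience of the proof
(contrast the two-sided moduli of `T4CurrencyMatching`, which contain it). [folklore] -/
theorem contLetter_loadBearing_on_orderRoads :
    ∃ β : HBeta, BetaLowerH 0 1 β ∧ BetaUpperH 1 1 β ∧
      (∀ (k : ℕ) (v v' : Fin (k + 1) → ℝ), v ∈ Box 1 k → v' ∈ Box 1 k → (∀ i, v i ≤ v' i) →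
        v (Fin.last k) = v' (Fin.last k) → β k v ≤ β k v') ∧
      (∀ (k : ℕ) (v : Fin (k + 1) → ℝ), v ∈ Box 1 k → ∀ x y : ℝ, 0 < x → x ≤ y → y ≤ 1 →
        β k (Function.update v (Fin.last k) x) - β k (Function.update v (Fin.last k) y) ≤ 0 * (1 / x ^ 2 - 1 / y ^ 2)) ∧
      (∀ (k : ℕ) (v : Fin (k + 1) → ℝ), v ∈ Box 1 k → ∀ x y : ℝ, 0 < x → x < y → y ≤ 1 →
        1 / y ^ 2 - β k (Function.update v (Fin.last k) y) < 1 / x ^ 2 - β k (Function.update v (Fin.last k) x)) ∧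
      (∀ (k : ℕ) (v v' : Fin (k + 1) → ℝ), v ∈ Box 1 k → v' ∈ Box 1 k → (∀ i, v i ≤ v' i) →
        β k v - β k v' ≤ ∑ i : Fin (k + 1), (fun (_ : ℕ) (_ : ℕ) => (0 : ℝ)) k i * (1 / (v i) ^ 2 - 1 / (v' i) ^ 2)) ∧
      (∀ γ : ℝ, 0 < γ → γ ≤ 1 → ∀ (n : ℕ) (gs gs' : ℕ → ℝ), RGEqH n β gs → RGEqH n β gs' →
        Step.InInterval γ n gs → Step.InInterval γ n gs' → gs 0 < gs' 0 → ∀ k, k ≤ n → gs k < gs' k) ∧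
      (∀ (γ : ℝ) (n : ℕ) (gs : ℕ → ℝ), RGEqH n β gs → Step.InInterval γ n gs → ∀ k, k ≤ n → gs k = γ → γ ≤ gs n) ∧
      ¬ EndpointExistence (modelOf β) ∧ (∀ γ₀ : ℝ, 0 < γ₀ → ¬ BetaContH γ₀ β) :=
  ⟨betaJ, betaLowerH_betaJ 1, betaUpperH_betaJ 1, cooperative_betaJ 1, diag_betaJ 1, anti_betaJ 1, oneSided_betaJ 1, hord_betaJ,
    fun _ n gs hrg hI => topRuns_betaJ n gs hrg hI, not_endpointExistence_betaJ, fun _ hγ₀ => not_betaContH_betaJ hγ₀⟩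

end

end Summit.QuantumFields.BalabanUV.Gaps.EndContLetterWitness
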